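import Mathlib
import HarnessLib
import Literature.MathematicalPhysics.QuantumLattice.GaugeGroups
import Literature.MathematicalPhysics.QuantumFieldTheory.ConstructiveQFTWave0
import Summits.Ventures.LatticeQCDFlow.Scaling.LatticeEntropy
import Summits.Ventures.LatticeQCDFlow.Scaling.LatticeEntropySUN
import Summits.Ventures.LatticeQCDFlow.Scaling.LatticeEntropyUN

/-!
# `SU(N)`: both one-plaquette inputs reduced to the Haar volume of action balls

HONEST FRAMING: exact (Metropolis-corrected) sampling algorithms for lattice gauge theory;
figures of merit are autocorrelation/cost numbers at stated couplings and volumes; no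
continuum-physics claim.

`Scaling/LatticeEntropySUN.lean` types the `SU(N)` entropy-growth law with two open one-plaquette
inputs, (H1) `SUN.OnePlaquetteDecay N` (`Z₁(β) ≤ A·β^{-(N²-1)/2}`) and (H2) `SUN.SmallBalls N`.
This file PROVES both from the two halves of one classical fact — the Haar probability of the
ACTION BALLS `B_r = {U ∈ SU(N) : s(U) ≤ r²}`, `s(U) := N - Re tr U = ½‖U - 1‖²_F`, scales like
`r^{N²-1} = r^{dim SU(N)}` — leaving exactly that fact as the open input:

* §1–2 matrix analysis (all PROVED): `SUN.action_eq_half_frob2` (`s(U) = ½Σ|U_{ij} - δ_{ij}|²` for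
  unitary `U`); `SUN.action_mul_le` (`s(UV) ≤ 2 s(U) + 2N² s(V)`, from `UV - 1 = U(V-1) + (U-1)`,
  `|a+b|² ≤ 2|a|² + 2|b|²`, `Σ|(UB)_{ij}|² ≤ N²Σ|B_{ij}|²`); `s(U⁻¹) = s(U)`; `s(1) = 0`; hence
  four-fold products from `{1} ∪ B_r ∪ B_r⁻¹` have action `≤ (8 + 14N²)·r²`;
* §3 `SUN.HaarActionBallLower N` (item: `Haar(B_r) ≥ a·r^{N²-1}`, `0 < r ≤ 1`) and
  `SUN.smallBalls_of_haarActionBallLower` (PROVED): `HaarActionBallLower N → SmallBalls N`;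
* §4 `SUN.HaarActionBallUpper N` (item: `Haar(B_r) ≤ A·r^{N²-1}`, `0 < r`) and
  `SUN.onePlaquetteDecay_of_haarActionBallUpper` (PROVED): `HaarActionBallUpper N →
  OnePlaquetteDecay N`, by the shell bound `e^{-βs} ≤ Σ_k e^{-k}·1{s ≤ (k+1)/β}` integrated
  against the ball volumes (`Z₁ ≤ A·S·β^{-(N²-1)/2}`, `S = Σ_k e^{-k}(k+1)^{(N²-1)/2} < ∞`);
* `SUN.entropyGrowthLaw_of_haarActionBalls` (PROVED):
  `HaarActionBallLower N → HaarActionBallUpper N → EntropyGrowthLaw d N`.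

The two volume items are the statement "`dim SU(N) = N² - 1`" in Haar-volume form (exponential
chart at `1`, where Haar measure has a smooth positive density); classical, absent from Mathlib.
For `U(1)` the analogous inputs are proved outright in `Scaling/LatticeEntropyU1.lean`. [folklore]
-/

noncomputable section

open MeasureTheory Literature.MathematicalPhysics.QuantumFieldTheory
open Literature.MathematicalPhysics.QuantumLattice (fundamentalRep fundamentalRep_apply
  continuous_fundamentalRep)

namespace Summit.Ventures.LatticeQCDFlow.Theory2.Lattice

namespace SUN

variable {N : ℕ}

/-! ## 1. Squared Frobenius size and the plaquette action of a unitary matrix -/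

/-- The squared Frobenius size `Σ_{ij} |M_{ij}|²` of a complex `N × N` matrix. [folklore] -/
def frob2 (M : Matrix (Fin N) (Fin N) ℂ) : ℝ := ∑ i, ∑ j, ‖M i j‖ ^ 2

/-- `frob2` is non-negative. [folklore] -/
theorem frob2_nonneg (M : Matrix (Fin N) (Fin N) ℂ) : 0 ≤ frob2 M := by
  unfold frob2; positivity

/-- `Σ|(A + B)_{ij}|² ≤ 2Σ|A_{ij}|² + 2Σ|B_{ij}|²`. [folklore] -/
theorem frob2_add_le (A B : Matrix (Fin N) (Fin N) ℂ) :
    frob2 (A + B) ≤ 2 * frob2 A + 2 * frob2 B := by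
  unfold frob2
  rw [Finset.mul_sum, Finset.mul_sum, ← Finset.sum_add_distrib]
  refine Finset.sum_le_sum fun i _ => ?_
  rw [Finset.mul_sum, Finset.mul_sum, ← Finset.sum_add_distrib]
  refine Finset.sum_le_sum fun j _ => ?_
  rw [Matrix.add_apply]
  have h := pow_le_pow_left₀ (norm_nonneg _) (norm_add_le (A i j) (B i j)) 2
  nlinarith [h, sq_nonneg (‖A i j‖ - ‖B i j‖)]

/-- Left multiplication by a unitary matrix: `Σ|(UB)_{ij}|² ≤ N²·Σ|B_{ij}|²` (crude, from
`|U_{ik}| ≤ 1` and Cauchy–Schwarz; the truth is equality without `N²`). [folklore] -/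
theorem frob2_unitary_mul_le {U : Matrix (Fin N) (Fin N) ℂ}
    (hU : U ∈ Matrix.unitaryGroup (Fin N) ℂ) (B : Matrix (Fin N) (Fin N) ℂ) :
    frob2 (U * B) ≤ (N : ℝ) ^ 2 * frob2 B := by
  have hrow : ∀ i j, ‖(U * B) i j‖ ^ 2 ≤ (N : ℝ) * ∑ k, ‖B k j‖ ^ 2 := by
    intro i j
    have h1 : ‖(U * B) i j‖ ≤ ∑ k, ‖B k j‖ := by
      rw [Matrix.mul_apply]
      refine (norm_sum_le _ _).trans (Finset.sum_le_sum fun k _ => ?_)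
      rw [norm_mul]
      exact mul_le_of_le_one_left (norm_nonneg _) (entry_norm_bound_of_unitary hU i k)
    have h2 : (∑ k, ‖B k j‖) ^ 2 ≤ (N : ℝ) * ∑ k, ‖B k j‖ ^ 2 := by
      have := sq_sum_le_card_mul_sum_sq (s := (Finset.univ : Finset (Fin N)))
        (f := fun k => ‖B k j‖)
      simpa [Finset.card_univ, Fintype.card_fin] using this
    exact (pow_le_pow_left₀ (norm_nonneg _) h1 2).trans h2
  have hB : ∑ j, ∑ k, ‖B k j‖ ^ 2 = frob2 B := by
    unfold frob2; rw [Finset.sum_comm]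
  unfold frob2
  calc ∑ i, ∑ j, ‖(U * B) i j‖ ^ 2 ≤ ∑ _i : Fin N, ∑ j, (N : ℝ) * ∑ k, ‖B k j‖ ^ 2 :=
        Finset.sum_le_sum fun i _ => Finset.sum_le_sum fun j _ => hrow i j
    _ = (N : ℝ) ^ 2 * ∑ k, ∑ j, ‖B k j‖ ^ 2 := by
        rw [Finset.sum_const, Finset.card_univ, Fintype.card_fin, ← Finset.mul_sum,
          Finset.sum_comm, nsmul_eq_mul]
        ring

/-- Rows of a unitary matrix are unit vectors: `Σ_k |U_{ik}|² = 1`. [folklore] -/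
theorem sum_norm_sq_row {U : Matrix (Fin N) (Fin N) ℂ} (hU : U ∈ Matrix.unitaryGroup (Fin N) ℂ)
    (i : Fin N) : ∑ k, ‖U i k‖ ^ 2 = 1 := by
  have h : U * star U = 1 := Matrix.mem_unitaryGroup_iff.mp hU
  have hii : (U * star U) i i = 1 := by rw [h, Matrix.one_apply_eq]
  rw [Matrix.mul_apply] at hii
  simp only [Matrix.star_eq_conjTranspose, Matrix.conjTranspose_apply, Complex.star_def,
    Complex.mul_conj, Complex.normSq_eq_norm_sq] at hii
  exact_mod_cast hii

/-- **The plaquette action of a unitary matrix is half its squared Frobenius distance to `1`**: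
`N - Re tr U = ½ Σ_{ij} |U_{ij} - δ_{ij}|²`. [folklore] -/
theorem action_eq_half_frob2 {U : Matrix (Fin N) (Fin N) ℂ}
    (hU : U ∈ Matrix.unitaryGroup (Fin N) ℂ) :
    (N : ℝ) - U.trace.re = frob2 (U - 1) / 2 := by
  have hexp : ∀ i j : Fin N, ‖(U - 1) i j‖ ^ 2 =
      ‖U i j‖ ^ 2 + ((if i = j then (1 : ℝ) else 0) - 2 * if i = j then (U i j).re else 0) := by
    intro i j
    rw [Matrix.sub_apply, Matrix.one_apply, ← Complex.normSq_eq_norm_sq,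
      ← Complex.normSq_eq_norm_sq, Complex.normSq_sub]
    split_ifs with h
    · simp; ring
    · simp
  have hsum : frob2 (U - 1) =
      ∑ i, ∑ j, ‖U i j‖ ^ 2 + (∑ i : Fin N, ∑ j : Fin N, (if i = j then (1 : ℝ) else 0) -
        2 * ∑ i : Fin N, ∑ j : Fin N, if i = j then (U i j).re else 0) := by
    unfold frob2
    simp only [hexp, Finset.sum_add_distrib, Finset.sum_sub_distrib, Finset.mul_sum]
  have hrows : ∑ i, ∑ j, ‖U i j‖ ^ 2 = (N : ℝ) := by
    simp only [sum_norm_sq_row hU, Finset.sum_const, Finset.card_univ, Fintype.card_fin,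
      nsmul_eq_mul, mul_one]
  have hdiag : ∑ i : Fin N, ∑ j : Fin N, (if i = j then (1 : ℝ) else 0) = (N : ℝ) := by
    simp
  have htr : ∑ i : Fin N, ∑ j : Fin N, (if i = j then (U i j).re else 0) = U.trace.re := by
    simp [Matrix.trace, Complex.re_sum]
  rw [hsum, hrows, hdiag, htr]
  ring

/-! ## 2. The action on `SU(N)`: `s(1) = 0`, `s(U⁻¹) = s(U)`, `s(UV) ≤ 2 s(U) + 2N² s(V)` -/

/-- The one-plaquette action `s(U) = N - Re tr U` on `SU(N)` (fundamental representation).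
[folklore] -/
def action (N : ℕ) (U : Matrix.specialUnitaryGroup (Fin N) ℂ) : ℝ :=
  (N : ℝ) - (fundamentalRep (Fin N) U).trace.re

/-- `s(U) = N - Re tr U` with the representation unfolded to the matrix `U`. [folklore] -/
theorem action_def (U : Matrix.specialUnitaryGroup (Fin N) ℂ) :
    action N U = (N : ℝ) - ((U : Matrix (Fin N) (Fin N) ℂ)).trace.re := rfl

/-- `s(U) = ½ Σ|U_{ij} - δ_{ij}|²` on `SU(N)`. [folklore] -/
theorem action_eq (U : Matrix.specialUnitaryGroup (Fin N) ℂ) :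
    action N U = frob2 ((U : Matrix (Fin N) (Fin N) ℂ) - 1) / 2 :=
  action_eq_half_frob2 (Matrix.specialUnitaryGroup_le_unitaryGroup U.2)

/-- `s ≥ 0`. [folklore] -/
theorem action_nonneg (U : Matrix.specialUnitaryGroup (Fin N) ℂ) : 0 ≤ action N U := by
  rw [action_eq]; exact div_nonneg (frob2_nonneg _) two_pos.le

/-- `s(1) = 0`. [folklore] -/
theorem action_one : action N 1 = 0 := by
  rw [action_eq]; simp [frob2]

/-- `s(U⁻¹) = s(U)` (`U⁻¹ = U†`, `tr U† = conj tr U`). [folklore] -/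
theorem action_inv (U : Matrix.specialUnitaryGroup (Fin N) ℂ) : action N U⁻¹ = action N U := by
  rw [action_def, action_def]
  have : ((U⁻¹ : Matrix.specialUnitaryGroup (Fin N) ℂ) : Matrix (Fin N) (Fin N) ℂ) =
      star (U : Matrix (Fin N) (Fin N) ℂ) := rfl
  rw [this, Matrix.star_eq_conjTranspose, Matrix.trace_conjTranspose, Complex.star_def,
    Complex.conj_re]

/-- **Quasi-subadditivity of the action**: `s(UV) ≤ 2 s(U) + 2N² s(V)` on `SU(N)`. [folklore] -/
theorem action_mul_le (U V : Matrix.specialUnitaryGroup (Fin N) ℂ) :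
    action N (U * V) ≤ 2 * action N U + 2 * (N : ℝ) ^ 2 * action N V := by
  rw [action_eq, action_eq, action_eq]
  have hU : (U : Matrix (Fin N) (Fin N) ℂ) ∈ Matrix.unitaryGroup (Fin N) ℂ :=
    Matrix.specialUnitaryGroup_le_unitaryGroup U.2
  have hsplit : ((U * V : Matrix.specialUnitaryGroup (Fin N) ℂ) : Matrix (Fin N) (Fin N) ℂ) - 1 =
      (U : Matrix (Fin N) (Fin N) ℂ) * ((V : Matrix (Fin N) (Fin N) ℂ) - 1) +
        ((U : Matrix (Fin N) (Fin N) ℂ) - 1) := by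
    push_cast
    rw [mul_sub, mul_one]
    abel
  rw [hsplit]
  have h1 := frob2_add_le ((U : Matrix (Fin N) (Fin N) ℂ) * ((V : Matrix (Fin N) (Fin N) ℂ) - 1))
    ((U : Matrix (Fin N) (Fin N) ℂ) - 1)
  have h2 := frob2_unitary_mul_le hU ((V : Matrix (Fin N) (Fin N) ℂ) - 1)
  nlinarith [h1, h2, frob2_nonneg ((V : Matrix (Fin N) (Fin N) ℂ) - 1), sq_nonneg (N : ℝ)]

/-- The action is continuous on `SU(N)`. [folklore] -/
theorem continuous_action : Continuous (action N) :=
  continuous_const.sub (Complex.continuous_re.comp (continuous_fundamentalRep (Fin N)).matrix_trace)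

/-- The action balls `{U : s(U) ≤ t}` are closed, hence measurable. [folklore] -/
theorem measurableSet_actionBall (t : ℝ) :
    MeasurableSet {U : Matrix.specialUnitaryGroup (Fin N) ℂ | action N U ≤ t} :=
  (isClosed_le continuous_action continuous_const).measurableSet

/-- Four-fold products from `{1} ∪ B ∪ B⁻¹`, `B = {s ≤ r²}`, have action `≤ (8 + 14N²)·r²`.
[folklore] -/
theorem action_fourfold_le (r : ℝ) :
    ∀ g₁ ∈ insert (1 : Matrix.specialUnitaryGroup (Fin N) ℂ)
        ({U | action N U ≤ r ^ 2} ∪ {U | action N U ≤ r ^ 2}⁻¹),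
      ∀ g₂ ∈ insert (1 : Matrix.specialUnitaryGroup (Fin N) ℂ)
        ({U | action N U ≤ r ^ 2} ∪ {U | action N U ≤ r ^ 2}⁻¹),
      ∀ g₃ ∈ insert (1 : Matrix.specialUnitaryGroup (Fin N) ℂ)
        ({U | action N U ≤ r ^ 2} ∪ {U | action N U ≤ r ^ 2}⁻¹),
      ∀ g₄ ∈ insert (1 : Matrix.specialUnitaryGroup (Fin N) ℂ)
        ({U | action N U ≤ r ^ 2} ∪ {U | action N U ≤ r ^ 2}⁻¹),
        action N (g₁ * g₂ * g₃ * g₄) ≤ (8 + 14 * (N : ℝ) ^ 2) * r ^ 2 := by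
  have hmem : ∀ g ∈ insert (1 : Matrix.specialUnitaryGroup (Fin N) ℂ)
      ({U | action N U ≤ r ^ 2} ∪ {U | action N U ≤ r ^ 2}⁻¹), action N g ≤ r ^ 2 := by
    intro g hg
    rcases hg with rfl | hg | hg
    · rw [action_one]; positivity
    · exact hg
    · rw [Set.mem_inv, Set.mem_setOf_eq, action_inv] at hg; exact hg
  intro g₁ h₁ g₂ h₂ g₃ h₃ g₄ h₄
  have e₁ := hmem g₁ h₁; have e₂ := hmem g₂ h₂; have e₃ := hmem g₃ h₃; have e₄ := hmem g₄ h₄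
  have m12 := action_mul_le g₁ g₂
  have m123 := action_mul_le (g₁ * g₂) g₃
  have m1234 := action_mul_le (g₁ * g₂ * g₃) g₄
  have hN : (0 : ℝ) ≤ (N : ℝ) ^ 2 := sq_nonneg _
  nlinarith [m12, m123, m1234, e₁, e₂, e₃, e₄, hN, mul_nonneg hN (action_nonneg g₂),
    mul_nonneg hN (action_nonneg g₃), mul_nonneg hN (action_nonneg g₄), action_nonneg g₁]

/-! ## 3. (H2) from the Haar volume of action balls -/

/-- **Haar volume of action balls, lower half** (`N ≥ 1`): there is `a > 0` with
`Haar{U ∈ SU(N) : N - Re tr U ≤ r²} ≥ a·r^{N²-1}` for `0 < r ≤ 1`.  Since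
`N - Re tr U = ½‖U - 1‖²_F` these are the Frobenius balls about `1`; the statement is the lower
half of "`dim SU(N) = N² - 1`" in Haar-volume form (exponential chart at the identity; Haar
measure has a smooth positive density in the chart).  Classical; not in Mathlib. [folklore] -/
@[conjecture] def HaarActionBallLower (N : ℕ) : Prop :=
  1 ≤ N → ∃ a : ℝ, 0 < a ∧ ∀ r : ℝ, 0 < r → r ≤ 1 →
    a * r ^ ((N : ℝ) ^ 2 - 1) ≤
      ((haarProbability (Matrix.specialUnitaryGroup (Fin N) ℂ))
        {U | (N : ℝ) - (fundamentalRep (Fin N) U).trace.re ≤ r ^ 2}).toReal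

/-- **(H2) for `SU(N)` from the volume lower bound**: `HaarActionBallLower N → SmallBalls N`
(`B_ε = {s ≤ ε²}`, `b = 8 + 14N²`). [folklore] -/
theorem smallBalls_of_haarActionBallLower (N : ℕ) (h : HaarActionBallLower N) : SmallBalls N := by
  intro hN
  obtain ⟨a, ha, hvol⟩ := h hN
  refine ⟨a, 8 + 14 * (N : ℝ) ^ 2, ha, fun ε hε hε1 => ⟨{U | action N U ≤ ε ^ 2},
    measurableSet_actionBall (ε ^ 2), hvol ε hε hε1, ?_⟩⟩
  exact action_fourfold_le ε

/-! ## 4. (H1) from the Haar volume of action balls (upper half) -/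

/-- **Haar volume of action balls, upper half** (`N ≥ 1`): there is `A` with
`Haar{U ∈ SU(N) : N - Re tr U ≤ r²} ≤ A·r^{N²-1}` for `0 < r` — the upper half of
"`dim SU(N) = N² - 1`" in Haar-volume form.  Classical (exponential chart / Weyl integration
formula); not in Mathlib. [folklore] -/
@[conjecture] def HaarActionBallUpper (N : ℕ) : Prop :=
  1 ≤ N → ∃ A : ℝ, ∀ r : ℝ, 0 < r →
    ((haarProbability (Matrix.specialUnitaryGroup (Fin N) ℂ))
        {U | (N : ℝ) - (fundamentalRep (Fin N) U).trace.re ≤ r ^ 2}).toReal ≤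
      A * r ^ ((N : ℝ) ^ 2 - 1)

/-- **Shell bound**: `e^{-β s} ≤ Σ_k e^{-k}·1{s ≤ (k+1)/β}` (take `k = ⌊β s⌋`). [folklore] -/
theorem weight_le_tsum {β : ℝ} (hβ : 0 < β) (U : Matrix.specialUnitaryGroup (Fin N) ℂ) :
    ENNReal.ofReal (Real.exp (-(β * action N U))) ≤
      ∑' k : ℕ, ENNReal.ofReal (Real.exp (-(k : ℝ))) *
        {V : Matrix.specialUnitaryGroup (Fin N) ℂ |
          action N V ≤ ((k : ℝ) + 1) / β}.indicator 1 U := by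
  have hs := action_nonneg U
  set k₀ := ⌊β * action N U⌋₊ with hk₀
  have h1 : (k₀ : ℝ) ≤ β * action N U := Nat.floor_le (by positivity)
  have h2 : β * action N U < k₀ + 1 := Nat.lt_floor_add_one _
  have hmem : U ∈ {V : Matrix.specialUnitaryGroup (Fin N) ℂ |
      action N V ≤ ((k₀ : ℝ) + 1) / β} := by
    rw [Set.mem_setOf_eq, le_div_iff₀ hβ]; linarith [mul_comm β (action N U)]
  refine le_trans ?_ (ENNReal.le_tsum k₀)
  rw [Set.indicator_of_mem hmem, Pi.one_apply, mul_one]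
  exact ENNReal.ofReal_le_ofReal (Real.exp_le_exp.mpr (by linarith))

/-- **(H1) for `SU(N)` from the volume upper bound** (`Z₁(β) ≤ A·S·β^{-(N²-1)/2}` with
`S = Σ_k e^{-k}(k+1)^{(N²-1)/2}`, by summing the shell bound against the ball volumes).
[folklore] -/
theorem onePlaquetteDecay_of_haarActionBallUpper (N : ℕ) (h : HaarActionBallUpper N) :
    OnePlaquetteDecay N := by
  intro hN
  obtain ⟨A, hA⟩ := h hN
  set κ2 : ℝ := ((N : ℝ) ^ 2 - 1) / 2 with hκ2
  set μ := haarProbability (Matrix.specialUnitaryGroup (Fin N) ℂ) with hμ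
  have hAt : ∀ t : ℝ, 0 < t → (μ {U | action N U ≤ t}).toReal ≤ A * t ^ κ2 := by
    intro t ht
    have h1 := hA (Real.sqrt t) (Real.sqrt_pos.mpr ht)
    rw [Real.sq_sqrt ht.le, Real.sqrt_eq_rpow, ← Real.rpow_mul ht.le] at h1
    have e : (1 : ℝ) / 2 * ((N : ℝ) ^ 2 - 1) = κ2 := by rw [hκ2]; ring
    rw [e] at h1
    exact h1
  have hA0 : 0 ≤ A := by
    have h1 := hAt 1 one_pos
    rw [Real.one_rpow, mul_one] at h1
    exact le_trans ENNReal.toReal_nonneg h1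
  set u : ℕ → ℝ := fun k => Real.exp (-(k : ℝ)) * ((k : ℝ) + 1) ^ κ2 with hu
  have hu0 : ∀ k, 0 ≤ u k := fun k => by positivity
  have hus : Summable u :=
    UN.summable_shell κ2 (N ^ 2) (by rw [hκ2]; push_cast; nlinarith [sq_nonneg (N : ℝ)])
  set S := ∑' k, u k with hS
  have hS0 : 0 ≤ S := tsum_nonneg hu0
  refine ⟨A * S, fun β hβ => ?_⟩
  have hB : ∀ k : ℕ, MeasurableSet
      {V : Matrix.specialUnitaryGroup (Fin N) ℂ | action N V ≤ ((k : ℝ) + 1) / β} :=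
    fun k => measurableSet_actionBall _
  -- integrate the shell bound
  have hint : (∫⁻ U, ENNReal.ofReal (Real.exp (-(β * action N U))) ∂μ) ≤
      ∑' k : ℕ, ENNReal.ofReal (Real.exp (-(k : ℝ))) *
        μ {V | action N V ≤ ((k : ℝ) + 1) / β} := by
    calc (∫⁻ U, ENNReal.ofReal (Real.exp (-(β * action N U))) ∂μ)
        ≤ ∫⁻ U, ∑' k : ℕ, ENNReal.ofReal (Real.exp (-(k : ℝ))) *
            {V : Matrix.specialUnitaryGroup (Fin N) ℂ |
              action N V ≤ ((k : ℝ) + 1) / β}.indicator 1 U ∂μ :=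
          lintegral_mono fun U => weight_le_tsum hβ U
      _ = ∑' k : ℕ, ∫⁻ U, ENNReal.ofReal (Real.exp (-(k : ℝ))) *
            {V : Matrix.specialUnitaryGroup (Fin N) ℂ |
              action N V ≤ ((k : ℝ) + 1) / β}.indicator 1 U ∂μ :=
          lintegral_tsum fun k => ((measurable_one.indicator (hB k)).const_mul _).aemeasurable
      _ = _ := by
          refine tsum_congr fun k => ?_
          rw [lintegral_const_mul _ (measurable_one.indicator (hB k)),
            lintegral_indicator_one (hB k)]
  -- bound each ball volume
  have hterm : ∀ k : ℕ, ENNReal.ofReal (Real.exp (-(k : ℝ))) *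
      μ {V | action N V ≤ ((k : ℝ) + 1) / β} ≤ ENNReal.ofReal (A * β ^ (-κ2) * u k) := by
    intro k
    have htk : 0 < ((k : ℝ) + 1) / β := by positivity
    have hμk : μ {V | action N V ≤ ((k : ℝ) + 1) / β} ≤
        ENNReal.ofReal (A * (((k : ℝ) + 1) / β) ^ κ2) := by
      rw [← ENNReal.ofReal_toReal (measure_ne_top μ _)]
      exact ENNReal.ofReal_le_ofReal (hAt _ htk)
    have hβκ : 0 < β ^ κ2 := Real.rpow_pos_of_pos hβ _
    calc ENNReal.ofReal (Real.exp (-(k : ℝ))) * μ {V | action N V ≤ ((k : ℝ) + 1) / β}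
        ≤ ENNReal.ofReal (Real.exp (-(k : ℝ))) *
            ENNReal.ofReal (A * (((k : ℝ) + 1) / β) ^ κ2) :=
          mul_le_mul_of_nonneg_left hμk bot_le
      _ = ENNReal.ofReal (A * β ^ (-κ2) * u k) := by
          rw [← ENNReal.ofReal_mul (Real.exp_pos _).le]
          congr 1
          simp only [hu]
          rw [Real.div_rpow (by positivity) hβ.le, Real.rpow_neg hβ.le]
          field_simp
  -- sum the series
  have hsum : (∑' k : ℕ, ENNReal.ofReal (A * β ^ (-κ2) * u k)) =
      ENNReal.ofReal (A * β ^ (-κ2) * S) := by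
    have e : (fun k : ℕ => ENNReal.ofReal (A * β ^ (-κ2) * u k)) =
        fun k => ENNReal.ofReal (A * β ^ (-κ2)) * ENNReal.ofReal (u k) := by
      funext k; rw [ENNReal.ofReal_mul (by positivity)]
    rw [e, ENNReal.tsum_mul_left, ← ENNReal.ofReal_tsum_of_nonneg hu0 hus,
      ← ENNReal.ofReal_mul (by positivity)]
  have hfin := hint.trans ((ENNReal.tsum_le_tsum hterm).trans hsum.le)
  have key : (∫⁻ U, ENNReal.ofReal (Real.exp (-(β * action N U))) ∂μ).toReal ≤
      A * S * β ^ (-κ2) :=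
    calc (∫⁻ U, ENNReal.ofReal (Real.exp (-(β * action N U))) ∂μ).toReal
        ≤ (ENNReal.ofReal (A * β ^ (-κ2) * S)).toReal :=
          ENNReal.toReal_mono ENNReal.ofReal_ne_top hfin
      _ = A * S * β ^ (-κ2) := by rw [ENNReal.toReal_ofReal (by positivity)]; ring
  exact key

/-- **The `SU(N)` law from the two Haar-volume bounds alone**:
`HaarActionBallLower N → HaarActionBallUpper N → EntropyGrowthLaw d N`. [folklore] -/
theorem entropyGrowthLaw_of_haarActionBalls (d N : ℕ) (hlo : HaarActionBallLower N)
    (hup : HaarActionBallUpper N) : EntropyGrowthLaw d N :=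
  entropyGrowthLaw_of d N (onePlaquetteDecay_of_haarActionBallUpper N hup)
    (smallBalls_of_haarActionBallLower N hlo)

/-- **The `SU(N)` law from (H1) and the volume lower bound**:
`OnePlaquetteDecay N → HaarActionBallLower N → EntropyGrowthLaw d N`. [folklore] -/
theorem entropyGrowthLaw_of' (d N : ℕ) (h1 : OnePlaquetteDecay N) (h2 : HaarActionBallLower N) :
    EntropyGrowthLaw d N :=
  entropyGrowthLaw_of d N h1 (smallBalls_of_haarActionBallLower N h2)

end SUN

end Summit.Ventures.LatticeQCDFlow.Theory2.Lattice

end
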